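import Summits.QuantumFields.BalabanUV.Beta.GradedStencilDictionary
import Literature.MathematicalPhysics.QuantumFieldTheory.Balaban1983to89.Beta.PlaquetteStencil

/-!
# `Beta.WilsonStencilZ4` — the Wilson action's first-order one-bond vertex as a GRADED `ℤ⁴` stencil:
# `wilsonStn = mainStn ++ remStn`, `Graded 1 mainStn`, `Graded 2 remStn`, realised letter for letter on every finite torus

HONEST FRAMING (cell `pub-balaban`, β sub-cell, analysis prover AN3, generation 16; part 2 of 3 of LEAF 2 «REMAINDER-LOG-FREE»;
tree target `Summits/QuantumFields/BalabanUV/Beta/`).  Discharging `BetaPertH` would make Bałaban's ultraviolet stability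
UNCONDITIONAL — a real constructive-QFT result; it is NOT the continuum limit and NOT the Clay problem.  This file is ELEMENTARY:
it TRANSCRIBES the located-pair vertices of `Beta.PlaquetteStencil` (an3, [folklore] bookkeeping of the Wilson plaquette action's
`B`-linear one-bond Hessian vertex: `wilsonVertex₁ = vecVertex sTot + 2•divVertex + remVertex₁`) into `ℤ⁴` stencils of
`Beta.GradedBubbles` BUILT FROM THE `Graded` CONSTRUCTORS, so that their grading is a certificate by construction, and proves with the
kernel that the realisation map `GradedStencilDictionary.real` sends each transcription back to the Literature matrix, on every
finite abelian `Λ`, every frame `e : Fin 4 → Λ`, every bond `(z, γ)` and every colour matrix `A`.  Value = β-function BOOKKEEPING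
made rigorous (the input «the remainder vertex is a second-order difference stencil» of the log-free count); NOT summit progress.

ABSOLUTE RULE.  No internally-minted statement may enter as a cited fact.  Every hypothesis is either kernel-proved in this package
or a verbatim quotation of a PUBLISHED theorem with page reference.  The manuscript(s) under audit are NOT citable for their own
disputed steps — they are the thing under adjudication; programme-internal (2001/route/tribunal) claims are never citable.  In this
file NOTHING is cited and nothing is assumed: all statements are definitional unfoldings + `abel`, against the UNMODIFIED definitions
of `PlaquetteStencil`, `SpinTable`, `GhostTable`, `BubbleTable`, `GradedBubbles` (imported BY NAME).

WHAT IS PROVED ([folklore] throughout; `D = Fin 4`, internal index `I = C × Fin 4`, `u_μ = unitVec μ`).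
* §1 building blocks: the origin pair `pt m`, the JOINT DIFFERENCE `jointDiff a b V = rowDiff a (colSh b V) ++ colDiff b V`
  (`real`: `τ_{(a,b)} − 1` on the two base points; `Graded (n+1)` from unit steps `a, b`), and the ONE-BOND SUM of a stencil family
  `bondStn γ F = ++_μ (jointDiff (−u_μ) (−u_μ) (F μ γ) ++ (−1)•jointDiff (−u_μ) (−u_μ) (F γ μ))` with
  `real e z z (bondStn γ F) = PlaquetteStencil.bondSum e z γ K` whenever `real e s s (F α β) = K s α β` (`real_bondStn`), raising the
  grading by one (`graded_bondStn`).
* §2 the three REMAINDER pieces `farStn`, `diffStn`, `transportStn` (`Graded 1`, realised to `farIns`, `diffIns`, `transportIns`) and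
  `remStn γ A := (−½)•bondStn(diffStn) ++ bondStn(transportStn) ++ (−1)•bondStn(farStn)` with **`Graded 2 (remStn γ A)`** and
  **`real e z z (remStn γ A) = remVertex₁ e z γ A`**.
* §3 the MAIN pieces: `currentStn`, `spinStn`, `vecStn s = currentStn ++ s•spinStn` (realised to `SpinTable.vecVertex s`), `divStn`
  (realised to `divVertex`), `mainStn γ A := vecStn sTot γ A ++ 2•divStn γ A` with `Graded 1`, and
  `wilsonStn γ A := mainStn γ A ++ remStn γ A` with **`real e z z (wilsonStn γ A) = wilsonVertex₁ e z γ A`**.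

NOT PROVED HERE, NOT CLAIMED: any estimate (part 3 `RemainderLogFree` draws the decay consequence from `GradedBubbles.isO_seven`);
anything about Bałaban's propagators, the volume or continuum limit, `BetaPertH`, or the Clay problem.
-/

namespace Summit.QuantumFields.BalabanUV.Beta.WilsonStencilZ4

open Finset
open scoped BigOperators
open Literature.MathematicalPhysics.QuantumFieldTheory.Balaban1983to89.Beta
open Literature.MathematicalPhysics.QuantumFieldTheory.Balaban1983to89.Beta.DyadicShell (Pt)
open Literature.MathematicalPhysics.QuantumFieldTheory.Balaban1983to89.Beta.BubbleTransfer (unitVec)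
open Literature.MathematicalPhysics.QuantumFieldTheory.Balaban1983to89.Beta.BubbleTable (elemIns)
open Literature.MathematicalPhysics.QuantumFieldTheory.Balaban1983to89.Beta.GhostTable (copies current)
open Literature.MathematicalPhysics.QuantumFieldTheory.Balaban1983to89.Beta.SpinTable (spinMat spinVertex vecVertex)
open Literature.MathematicalPhysics.QuantumFieldTheory.Balaban1983to89.Beta.PlaquetteWeitzenbock (sTot)
open Literature.MathematicalPhysics.QuantumFieldTheory.Balaban1983to89.Beta.PlaquetteStencil (dirBlock pairIns bondSum divVertex
  farIns diffIns transportIns spinFarDiffVertex spinDiffVertex transportFVertex remVertex₁ wilsonVertex₁)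
open Literature.MathematicalPhysics.QuantumFieldTheory.Balaban1983to89.Beta.GradedBubbles
open Summit.QuantumFields.BalabanUV.Beta.GradedStencilDictionary

/-! ## §1 Building blocks: origin pair, joint difference, one-bond sum -/

section Blocks

variable {I : Type*}

/-- the located pair at the origin with internal matrix `m`.  A definition asserting nothing. [folklore] -/
def pt (m : Matrix I I ℝ) : Stn I := [⟨0, 0, m⟩]

/-- THE JOINT DIFFERENCE `τ_{(a,b)} V − V` (row sites moved by `a`, column sites by `b`), written with the `Graded` constructors:
`rowDiff a (colSh b V) ++ colDiff b V`.  A definition asserting nothing. [folklore] -/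
def jointDiff (a b : Pt) (V : Stn I) : Stn I := rowDiff a (colSh b V) ++ colDiff b V

/-- `+u_i` is a unit step. [folklore] -/
theorem isStep_unitVec (i : Fin 4) : IsStep (unitVec i) := ⟨i, Or.inl rfl⟩

/-- `−u_i` is a unit step. [folklore] -/
theorem isStep_neg_unitVec (i : Fin 4) : IsStep (-unitVec i) := ⟨i, Or.inr rfl⟩

/-- grading of the joint difference: one more than its argument. [folklore] -/
theorem graded_jointDiff {n : ℕ} {V : Stn I} {a b : Pt} (ha : IsStep a) (hb : IsStep b) (hV : Graded n V) :
    Graded (n + 1) (jointDiff a b V) :=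
  Graded.append (Graded.rowDiff ha (Graded.colSh b hV)) (Graded.colDiff hb hV)

/-- ONE BOND TERM of a stencil family `F : D → D → Stn I` at the bond direction `γ`, summand `μ`:
`(τ_{−u_μ} − 1)(F μ γ) ++ (−1)•(τ_{−u_μ} − 1)(F γ μ)`.  A definition asserting nothing. [folklore] -/
def bondTerm (γ : Fin 4) (F : Fin 4 → Fin 4 → Stn I) (μ : Fin 4) : Stn I :=
  jointDiff (-unitVec μ) (-unitVec μ) (F μ γ) ++ smulS (-1) (jointDiff (-unitVec μ) (-unitVec μ) (F γ μ))

/-- THE ONE-BOND SUM of a stencil family (the `ℤ⁴` side of `PlaquetteStencil.bondSum`): the four bond terms concatenated.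
A definition asserting nothing. [folklore] -/
def bondStn (γ : Fin 4) (F : Fin 4 → Fin 4 → Stn I) : Stn I :=
  bondTerm γ F 0 ++ bondTerm γ F 1 ++ bondTerm γ F 2 ++ bondTerm γ F 3

/-- grading of a bond term. [folklore] -/
theorem graded_bondTerm {n : ℕ} (γ : Fin 4) {F : Fin 4 → Fin 4 → Stn I} (hF : ∀ α β, Graded n (F α β)) (μ : Fin 4) :
    Graded (n + 1) (bondTerm γ F μ) :=
  Graded.append (graded_jointDiff (isStep_neg_unitVec μ) (isStep_neg_unitVec μ) (hF μ γ))
    (Graded.smul _ (graded_jointDiff (isStep_neg_unitVec μ) (isStep_neg_unitVec μ) (hF γ μ)))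

/-- **the one-bond sum raises the grading by one**. [folklore] -/
theorem graded_bondStn {n : ℕ} (γ : Fin 4) {F : Fin 4 → Fin 4 → Stn I} (hF : ∀ α β, Graded n (F α β)) :
    Graded (n + 1) (bondStn γ F) :=
  Graded.append (Graded.append (Graded.append (graded_bondTerm γ hF 0) (graded_bondTerm γ hF 1)) (graded_bondTerm γ hF 2))
    (graded_bondTerm γ hF 3)

variable {Λ : Type*} [DecidableEq Λ] [AddCommGroup Λ] (e : Fin 4 → Λ)

/-- realisation of the origin pair. [folklore] -/
@[simp] theorem real_pt (zr zc : Λ) (m : Matrix I I ℝ) : real e zr zc (pt m) = elemIns zr zc m := by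
  simp [pt]

/-- realisation of the joint difference: both base points move. [folklore] -/
theorem real_jointDiff (zr zc : Λ) (a b : Pt) (V : Stn I) :
    real e zr zc (jointDiff a b V) = real e (zr + lift e a) (zc + lift e b) V - real e zr zc V := by
  rw [jointDiff, real_append, real_rowDiff, real_colSh, real_colSh, real_colDiff]
  abel

variable {C : Type*}

/-- realisation of a bond term (internal index `C × Fin 4`, the format of `PlaquetteStencil`). [folklore] -/
theorem real_bondTerm (z : Λ) (γ : Fin 4) (F : Fin 4 → Fin 4 → Stn (C × Fin 4))
    (K : Λ → Fin 4 → Fin 4 → Matrix (Λ × (C × Fin 4)) (Λ × (C × Fin 4)) ℝ) (hF : ∀ s α β, real e s s (F α β) = K s α β)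
    (μ : Fin 4) : real e z z (bondTerm γ F μ) = K (z - e μ) μ γ - K z μ γ - K (z - e μ) γ μ + K z γ μ := by
  simp only [bondTerm, real_append, real_smulS, real_jointDiff, lift_neg_unitVec, ← sub_eq_add_neg, hF, neg_one_smul]
  abel

/-- **realisation of the one-bond sum = `PlaquetteStencil.bondSum`**. [folklore] -/
theorem real_bondStn (z : Λ) (γ : Fin 4) (F : Fin 4 → Fin 4 → Stn (C × Fin 4))
    (K : Λ → Fin 4 → Fin 4 → Matrix (Λ × (C × Fin 4)) (Λ × (C × Fin 4)) ℝ) (hF : ∀ s α β, real e s s (F α β) = K s α β) :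
    real e z z (bondStn γ F) = bondSum e z γ K := by
  rw [bondStn, real_append, real_append, real_append, real_bondTerm e z γ F K hF, real_bondTerm e z γ F K hF,
    real_bondTerm e z γ F K hF, real_bondTerm e z γ F K hF, bondSum, Fin.sum_univ_four]

end Blocks

/-! ## §2 The remainder vertex as a stencil of grading two -/

section Remainder

variable {C : Type*}

/-- far-corner piece `(τ_{(u_β,u_α)} − 1)(pt (A ⊗ e_{αβ}))` (realised: `farIns`).  A definition asserting nothing. [folklore] -/
def farStn (α β : Fin 4) (A : Matrix C C ℝ) : Stn (C × Fin 4) := jointDiff (unitVec β) (unitVec α) (pt (dirBlock α β A))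

/-- difference piece (realised: `diffIns`, term by term).  A definition asserting nothing. [folklore] -/
def diffStn (α β : Fin 4) (A : Matrix C C ℝ) : Stn (C × Fin 4) :=
  smulS 2 (colDiff (unitVec α) (pt (dirBlock α β A))) ++ smulS (-2) (colDiff (unitVec β) (pt (dirBlock β α A)))
    ++ smulS (-1) (colDiff (unitVec β) (pt (dirBlock α α A))) ++ colDiff (unitVec α) (pt (dirBlock β β A))
    ++ smulS (-1) (rowDiff (unitVec α) (colDiff (unitVec β) (pt (dirBlock β α A))))

/-- transport piece (realised: `transportIns`, term by term).  A definition asserting nothing. [folklore] -/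
def transportStn (α β : Fin 4) (A : Matrix C C ℝ) : Stn (C × Fin 4) :=
  colDiff (unitVec α) (rowSh (unitVec β) (pt (dirBlock α β A)))
    ++ smulS (-1) (colDiff (unitVec β) (rowSh (unitVec β) (pt (dirBlock α α A))))
    ++ colDiff (unitVec α) (pt (dirBlock β β A)) ++ smulS (-1) (colDiff (unitVec β) (pt (dirBlock β α A)))

/-- `ℤ⁴` side of `spinFarDiffVertex`.  A definition asserting nothing. [folklore] -/
def spinFarDiffStn (γ : Fin 4) (A : Matrix C C ℝ) : Stn (C × Fin 4) := bondStn γ fun α β => farStn α β A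

/-- `ℤ⁴` side of `spinDiffVertex`.  A definition asserting nothing. [folklore] -/
def spinDiffStn (γ : Fin 4) (A : Matrix C C ℝ) : Stn (C × Fin 4) := bondStn γ fun α β => diffStn α β A

/-- `ℤ⁴` side of `transportFVertex`.  A definition asserting nothing. [folklore] -/
def transportFStn (γ : Fin 4) (A : Matrix C C ℝ) : Stn (C × Fin 4) := bondStn γ fun α β => transportStn α β A

/-- **THE REMAINDER STENCIL** `(−½)•spinDiffStn ++ transportFStn ++ (−1)•spinFarDiffStn` (realised: `remVertex₁`).  A definition
asserting nothing. [folklore] -/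
noncomputable def remStn (γ : Fin 4) (A : Matrix C C ℝ) : Stn (C × Fin 4) :=
  smulS (-(2 : ℝ)⁻¹) (spinDiffStn γ A) ++ transportFStn γ A ++ smulS (-1) (spinFarDiffStn γ A)

/-- `Graded 1 (farStn α β A)`. [folklore] -/
theorem graded_farStn (α β : Fin 4) (A : Matrix C C ℝ) : Graded 1 (farStn α β A) :=
  graded_jointDiff (isStep_unitVec β) (isStep_unitVec α) (Graded.zero _)

/-- `Graded 1 (diffStn α β A)`. [folklore] -/
theorem graded_diffStn (α β : Fin 4) (A : Matrix C C ℝ) : Graded 1 (diffStn α β A) :=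
  Graded.append
    (Graded.append
      (Graded.append
        (Graded.append (Graded.smul _ (Graded.colDiff (isStep_unitVec α) (Graded.zero _)))
          (Graded.smul _ (Graded.colDiff (isStep_unitVec β) (Graded.zero _))))
        (Graded.smul _ (Graded.colDiff (isStep_unitVec β) (Graded.zero _))))
      (Graded.colDiff (isStep_unitVec α) (Graded.zero _)))
    (Graded.smul _ (Graded.weaken (Graded.rowDiff (isStep_unitVec α) (Graded.colDiff (isStep_unitVec β) (Graded.zero _)))))

/-- `Graded 1 (transportStn α β A)`. [folklore] -/
theorem graded_transportStn (α β : Fin 4) (A : Matrix C C ℝ) : Graded 1 (transportStn α β A) :=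
  Graded.append
    (Graded.append
      (Graded.append (Graded.colDiff (isStep_unitVec α) (Graded.rowSh _ (Graded.zero _)))
        (Graded.smul _ (Graded.colDiff (isStep_unitVec β) (Graded.rowSh _ (Graded.zero _)))))
      (Graded.colDiff (isStep_unitVec α) (Graded.zero _)))
    (Graded.smul _ (Graded.colDiff (isStep_unitVec β) (Graded.zero _)))

/-- **`Graded 2 (remStn γ A)`** — the remainder vertex is a second-order difference stencil (one difference inside each plaquette
piece, one from the one-bond sum). [folklore] -/
theorem graded_remStn (γ : Fin 4) (A : Matrix C C ℝ) : Graded 2 (remStn γ A) :=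
  Graded.append
    (Graded.append (Graded.smul _ (graded_bondStn γ fun α β => graded_diffStn α β A))
      (graded_bondStn γ fun α β => graded_transportStn α β A))
    (Graded.smul _ (graded_bondStn γ fun α β => graded_farStn α β A))

variable {Λ : Type*} [DecidableEq Λ] [AddCommGroup Λ] (e : Fin 4 → Λ)

/-- `real e s s (farStn α β A) = farIns e s α β A`. [folklore] -/
theorem real_farStn (s : Λ) (α β : Fin 4) (A : Matrix C C ℝ) : real e s s (farStn α β A) = farIns e s α β A := by
  simp only [farStn, farIns, pairIns, real_jointDiff, real_pt, lift_unitVec]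

/-- `real e s s (diffStn α β A) = diffIns e s α β A`. [folklore] -/
theorem real_diffStn (s : Λ) (α β : Fin 4) (A : Matrix C C ℝ) : real e s s (diffStn α β A) = diffIns e s α β A := by
  simp only [diffStn, diffIns, pairIns, real_append, real_smulS, real_rowDiff, real_colDiff, real_pt, lift_unitVec, smul_sub,
    two_smul, neg_smul, one_smul]
  abel

/-- `real e s s (transportStn α β A) = transportIns e s α β A`. [folklore] -/
theorem real_transportStn (s : Λ) (α β : Fin 4) (A : Matrix C C ℝ) :
    real e s s (transportStn α β A) = transportIns e s α β A := by
  simp only [transportStn, transportIns, pairIns, real_append, real_smulS, real_colDiff, real_rowSh, real_pt, lift_unitVec,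
    neg_smul, one_smul]
  abel

/-- `real e z z (spinFarDiffStn γ A) = spinFarDiffVertex e z γ A`. [folklore] -/
theorem real_spinFarDiffStn (z : Λ) (γ : Fin 4) (A : Matrix C C ℝ) :
    real e z z (spinFarDiffStn γ A) = spinFarDiffVertex e z γ A :=
  real_bondStn e z γ _ _ fun s α β => real_farStn e s α β A

/-- `real e z z (spinDiffStn γ A) = spinDiffVertex e z γ A`. [folklore] -/
theorem real_spinDiffStn (z : Λ) (γ : Fin 4) (A : Matrix C C ℝ) : real e z z (spinDiffStn γ A) = spinDiffVertex e z γ A :=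
  real_bondStn e z γ _ _ fun s α β => real_diffStn e s α β A

/-- `real e z z (transportFStn γ A) = transportFVertex e z γ A`. [folklore] -/
theorem real_transportFStn (z : Λ) (γ : Fin 4) (A : Matrix C C ℝ) :
    real e z z (transportFStn γ A) = transportFVertex e z γ A :=
  real_bondStn e z γ _ _ fun s α β => real_transportStn e s α β A

/-- **THE REMAINDER DICTIONARY**: `real e z z (remStn γ A) = PlaquetteStencil.remVertex₁ e z γ A` on every finite torus. [folklore] -/
theorem real_remStn (z : Λ) (γ : Fin 4) (A : Matrix C C ℝ) : real e z z (remStn γ A) = remVertex₁ e z γ A := by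
  simp only [remStn, remVertex₁, real_append, real_smulS, real_spinDiffStn, real_transportFStn, real_spinFarDiffStn, neg_smul,
    one_smul]
  abel

end Remainder

/-! ## §3 The main (vector + longitudinal) vertex as a stencil of grading one, and the whole Wilson vertex -/

section Main

variable {C : Type*}

/-- the colour current `⊗ 1_D` as a stencil: `(ρ_{u_μ} − 1)(pt P) ++ (−1)•(σ_{u_μ} − 1)(pt P)`, `P = copies D A` (realised:
`GhostTable.current z (e μ) (copies D A)`).  A definition asserting nothing. [folklore] -/
def currentStn (μ : Fin 4) (A : Matrix C C ℝ) : Stn (C × Fin 4) :=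
  rowDiff (unitVec μ) (pt (copies (Fin 4) A)) ++ smulS (-1) (colDiff (unitVec μ) (pt (copies (Fin 4) A)))

/-- one spin term `(τ_{−u_β} − 1)(pt (spinMat β γ A))`.  A definition asserting nothing. [folklore] -/
def spinTerm (γ : Fin 4) (A : Matrix C C ℝ) (β : Fin 4) : Stn (C × Fin 4) :=
  jointDiff (-unitVec β) (-unitVec β) (pt (spinMat β γ A))

/-- the spin vertex as a stencil (realised: `SpinTable.spinVertex`).  A definition asserting nothing. [folklore] -/
def spinStn (γ : Fin 4) (A : Matrix C C ℝ) : Stn (C × Fin 4) :=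
  spinTerm γ A 0 ++ spinTerm γ A 1 ++ spinTerm γ A 2 ++ spinTerm γ A 3

/-- the model vector vertex `currentStn ++ s•spinStn` (realised: `SpinTable.vecVertex s`).  A definition asserting nothing.
[folklore] -/
def vecStn (s : ℝ) (γ : Fin 4) (A : Matrix C C ℝ) : Stn (C × Fin 4) := currentStn γ A ++ smulS s (spinStn γ A)

/-- one longitudinal term `(−1)•σ_{u_γ}(σ_{−u_μ} − 1)(pt (A ⊗ e_{γμ}))`.  A definition asserting nothing. [folklore] -/
def divTerm (γ : Fin 4) (A : Matrix C C ℝ) (μ : Fin 4) : Stn (C × Fin 4) :=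
  smulS (-1) (colSh (unitVec γ) (colDiff (-unitVec μ) (pt (dirBlock γ μ A))))

/-- the longitudinal vertex as a stencil (realised: `divVertex`).  A definition asserting nothing. [folklore] -/
def divStn (γ : Fin 4) (A : Matrix C C ℝ) : Stn (C × Fin 4) := divTerm γ A 0 ++ divTerm γ A 1 ++ divTerm γ A 2 ++ divTerm γ A 3

/-- **THE MAIN STENCIL** `vecStn sTot ++ 2•divStn` (realised: `vecVertex sTot + 2•divVertex`).  A definition asserting nothing.
[folklore] -/
def mainStn (γ : Fin 4) (A : Matrix C C ℝ) : Stn (C × Fin 4) := vecStn sTot γ A ++ smulS 2 (divStn γ A)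

/-- **THE WILSON STENCIL** `mainStn ++ remStn` (realised: `wilsonVertex₁`).  A definition asserting nothing. [folklore] -/
noncomputable def wilsonStn (γ : Fin 4) (A : Matrix C C ℝ) : Stn (C × Fin 4) := mainStn γ A ++ remStn γ A

/-- `Graded 1 (currentStn μ A)`. [folklore] -/
theorem graded_currentStn (μ : Fin 4) (A : Matrix C C ℝ) : Graded 1 (currentStn μ A) :=
  Graded.append (Graded.rowDiff (isStep_unitVec μ) (Graded.zero _))
    (Graded.smul _ (Graded.colDiff (isStep_unitVec μ) (Graded.zero _)))

/-- `Graded 1 (spinStn γ A)`. [folklore] -/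
theorem graded_spinStn (γ : Fin 4) (A : Matrix C C ℝ) : Graded 1 (spinStn γ A) :=
  have h : ∀ β, Graded 1 (spinTerm γ A β) := fun β =>
    graded_jointDiff (isStep_neg_unitVec β) (isStep_neg_unitVec β) (Graded.zero _)
  Graded.append (Graded.append (Graded.append (h 0) (h 1)) (h 2)) (h 3)

/-- `Graded 1 (vecStn s γ A)`. [folklore] -/
theorem graded_vecStn (s : ℝ) (γ : Fin 4) (A : Matrix C C ℝ) : Graded 1 (vecStn s γ A) :=
  Graded.append (graded_currentStn γ A) (Graded.smul _ (graded_spinStn γ A))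

/-- `Graded 1 (divStn γ A)`. [folklore] -/
theorem graded_divStn (γ : Fin 4) (A : Matrix C C ℝ) : Graded 1 (divStn γ A) :=
  have h : ∀ μ, Graded 1 (divTerm γ A μ) := fun μ =>
    Graded.smul _ (Graded.colSh _ (Graded.colDiff (isStep_neg_unitVec μ) (Graded.zero _)))
  Graded.append (Graded.append (Graded.append (h 0) (h 1)) (h 2)) (h 3)

/-- **`Graded 1 (mainStn γ A)`**. [folklore] -/
theorem graded_mainStn (γ : Fin 4) (A : Matrix C C ℝ) : Graded 1 (mainStn γ A) :=
  Graded.append (graded_vecStn sTot γ A) (Graded.smul _ (graded_divStn γ A))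

/-- `Graded 1 (wilsonStn γ A)` (the remainder part weakened). [folklore] -/
theorem graded_wilsonStn (γ : Fin 4) (A : Matrix C C ℝ) : Graded 1 (wilsonStn γ A) :=
  Graded.append (graded_mainStn γ A) (Graded.weaken (graded_remStn γ A))

variable {Λ : Type*} [DecidableEq Λ] [AddCommGroup Λ] (e : Fin 4 → Λ)

/-- `real e z z (currentStn μ A) = current z (e μ) (copies D A)`. [folklore] -/
theorem real_currentStn (z : Λ) (μ : Fin 4) (A : Matrix C C ℝ) :
    real e z z (currentStn μ A) = current z (e μ) (copies (Fin 4) A) := by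
  simp only [currentStn, current, real_append, real_smulS, real_rowDiff, real_colDiff, real_pt, lift_unitVec, neg_smul, one_smul]
  abel

/-- one spin term realised. [folklore] -/
theorem real_spinTerm (z : Λ) (γ : Fin 4) (A : Matrix C C ℝ) (β : Fin 4) :
    real e z z (spinTerm γ A β) = elemIns (z - e β) (z - e β) (spinMat β γ A) - elemIns z z (spinMat β γ A) := by
  simp only [spinTerm, real_jointDiff, real_pt, lift_neg_unitVec, ← sub_eq_add_neg]

/-- `real e z z (spinStn γ A) = spinVertex e z γ A`. [folklore] -/
theorem real_spinStn (z : Λ) (γ : Fin 4) (A : Matrix C C ℝ) : real e z z (spinStn γ A) = spinVertex e z γ A := by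
  rw [spinStn, real_append, real_append, real_append, real_spinTerm, real_spinTerm, real_spinTerm, real_spinTerm, spinVertex,
    Fin.sum_univ_four]

/-- `real e z z (vecStn s γ A) = vecVertex s e z γ A`. [folklore] -/
theorem real_vecStn (s : ℝ) (z : Λ) (γ : Fin 4) (A : Matrix C C ℝ) : real e z z (vecStn s γ A) = vecVertex s e z γ A := by
  rw [vecStn, real_append, real_smulS, real_currentStn, real_spinStn, vecVertex]

/-- one longitudinal term realised. [folklore] -/
theorem real_divTerm (z : Λ) (γ : Fin 4) (A : Matrix C C ℝ) (μ : Fin 4) :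
    real e z z (divTerm γ A μ) = pairIns z (z + e γ) γ μ A - pairIns z (z + e γ - e μ) γ μ A := by
  simp only [divTerm, pairIns, real_smulS, real_colSh, real_colDiff, real_pt, lift_unitVec, lift_neg_unitVec, ← sub_eq_add_neg,
    neg_smul, one_smul, neg_sub]

/-- `real e z z (divStn γ A) = divVertex e z γ A`. [folklore] -/
theorem real_divStn (z : Λ) (γ : Fin 4) (A : Matrix C C ℝ) : real e z z (divStn γ A) = divVertex e z γ A := by
  rw [divStn, real_append, real_append, real_append, real_divTerm, real_divTerm, real_divTerm, real_divTerm, divVertex,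
    Fin.sum_univ_four]

/-- `real e z z (mainStn γ A) = vecVertex sTot e z γ A + 2 • divVertex e z γ A`. [folklore] -/
theorem real_mainStn (z : Λ) (γ : Fin 4) (A : Matrix C C ℝ) :
    real e z z (mainStn γ A) = vecVertex sTot e z γ A + (2 : ℝ) • divVertex e z γ A := by
  rw [mainStn, real_append, real_smulS, real_vecStn, real_divStn]

/-- **THE WILSON DICTIONARY**: `real e z z (wilsonStn γ A) = PlaquetteStencil.wilsonVertex₁ e z γ A` on every finite torus, every
frame, every bond and colour matrix. [folklore] -/
theorem real_wilsonStn (z : Λ) (γ : Fin 4) (A : Matrix C C ℝ) : real e z z (wilsonStn γ A) = wilsonVertex₁ e z γ A := by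
  rw [wilsonStn, real_append, real_mainStn, real_remStn, wilsonVertex₁]

end Main

end Summit.QuantumFields.BalabanUV.Beta.WilsonStencilZ4
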